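import Mathlib
import Summits.ValiantsHypothesis.ValiantsHypothesis.Theorems.LiouvilleSarnakAlignedCutRank
import Summits.ValiantsHypothesis.ValiantsHypothesis.Theorems.LiouvilleSarnakLiouvilleCutRankPeriodicEngine
import HarnessLib

/-!
# Route LiouvilleSarnak — crux `LiouvilleCutRank` (stmt-ValiantsHypothesis-14775):
# the RATIO CRITERION — every periodic cut pattern with a finite arithmetic certificate has unbounded rank

For a PERIODIC cut pattern `u ∈ {R, C}^p` (row/column type of each of the `p` bit positions of a period;
`a` row bits and `a` column bits per period) the cut number splits as `N_π(r, c) = E_R(ofBits r) + E_C(ofBits c)`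
with "spreading maps" `E_R, E_C : ℕ → ℕ` placing base-`2^a` digits into base-`2^p` blocks:
`E_X(2^a x + d) = 2^p E_X(x) + pat_X(d)` (`d < 2^a`), `pat_R(2^a - 1) + pat_C(2^a - 1) + 1 = 2^p` (the row and
column positions partition a period).  This file proves, ABSTRACTLY in these data:

* §1 `spread_sum_digits`, `iterate_eq_sum` — `E(Σ_j d_j 2^{aj}) = Σ_j pat(d_j) 2^{pj}`; the substitution
  `x ↦ 2^a x + (2^a - 1)` iterated `L` times from `0` is `Σ_{j<L} (2^a - 1) 2^{aj}`.
* §2 ★ `infinite_rows_of_ratioWitness` — if there is `q ≥ 1` whose bit pattern and whose predecessor's bit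
  pattern are COLUMN patterns (`pat_C(d_q) = q`, `pat_C(d_q') = q - 1` for some digits `d_q, d_q' < 2^a`) and
  `λ(m_R + q) ≠ λ(q)` (`m_R = pat_R(2^a - 1)` = the row-position number of one period), then the infinite matrix
  `(λ(1 + E_R x + E_C y))_{x,y}` has infinitely many distinct rows.  Proof: the periodic engine
  (`…PeriodicEngine.exists_iterate_rows_eq`, self-similarity `λ(2^p m) = λ(2^p) λ(m)`) gives `L ≥ 1` with
  row `Σ_{j<L}(2^a-1)2^{aj}` (= all row bits of `L` periods) equal to row `0`; at the column
  `y = d_q' + Σ_{1≤j<L} d_q 2^{aj}` the two entries are `λ((m_R + q) G)` and `λ(q G)` with `G = Σ_{j<L} 2^{pj} ≥ 1`,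
  which differ.  [The ROTATION criterion of the census is `q = m_C` (`λ(m_C) ≠ λ(2^p - 1)`); the SHIFT / DIVISOR
  criteria are `q = m_R / (c - 1)`, `λ(c) = -1`.]
* §3 `cutRank_of_infinite_rows` — bridge: infinitely many rows of `(λ(1 + E_R x + E_C y))` ⟹ for every `W`,
  eventually every cut `π` with `N_π(r,c) = E_R(ofBits r) + E_C(ofBits c)` has rank `≥ W`;
  ★ `cutRank_of_ratioWitness` — the two combined.
* Instances already in the tree: `(CR)^n` (`a = 1`, `p = 2`, `E_C = e`, `E_R = 2e`, certificate `q = 1`: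
  `λ(2+1) ≠ λ(1)`; `…InterleavedUnbounded.interleavedCutRank`) and `(CCRR)^n` (`a = 2`, `p = 4`, `m_R = 12`, `m_C = 3`, certificate `q = 3`:
  `λ(15) ≠ λ(3)`; `…CcrrUnbounded.ccrrCutRank`); new families only need their digit bookkeeping `N_π = E_R + E_C`.

Census (evidence `evidence-14775-leafhand2-g5.md` on the item; local script numerics/periodic_ratio.py): EVERY
primitive balanced periodic pattern of period `p ≤ 14` (all 189 necklaces up to rotation and letter swap, and all
408 of period 16 by the rotation/divisor sub-criteria) admits such a certificate `q`, so all these cut families have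
unbounded rank by this theorem once their (routine) digit bookkeeping `N_π = E_R + E_C` is supplied (done in the
tree for `(CR)^n` and `(CCRR)^n`).  Honest framing: periodic cut families only; the crux `LiouvilleCutRank` (ALL
balanced cuts), `DigitalBilinearLiouville`, `AlgebraicSarnak` stay OPEN; nothing bears on `VP ≠ VNP`.  No
definitions.
-/

set_option linter.dupNamespace false

noncomputable section

namespace Summit.ValiantsHypothesis.ValiantsHypothesis.Theorems.LiouvilleSarnakLiouvilleCutRank.PeriodicRatio

open ArithmeticFunction Finset

open Summit.ValiantsHypothesis.ValiantsHypothesis.Theorems.LiouvilleSarnakAligned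
  (card_image_row_le_two_pow_rank)
open Summit.ValiantsHypothesis.ValiantsHypothesis.Theorems.LiouvilleSarnakLiouvilleCutRank.PeriodicEngine
  (exists_iterate_rows_eq)

/-! ### §1 Digit sums under a spreading map -/

/-- `E(Σ_{j<L} d_j 2^{aj}) = Σ_{j<L} pat(d_j) 2^{pj}` for digits `d_j < 2^a`, when `E(0) = 0` and
`E(2^a x + d) = 2^p E(x) + pat(d)`. [folklore] -/
theorem spread_sum_digits (E pat : ℕ → ℕ) (a p : ℕ) (hE0 : E 0 = 0)
    (hE : ∀ x d, d < 2 ^ a → E (2 ^ a * x + d) = 2 ^ p * E x + pat d) :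
    ∀ (L : ℕ) (dg : ℕ → ℕ), (∀ j, dg j < 2 ^ a) →
      E (∑ j ∈ Finset.range L, dg j * 2 ^ (a * j)) = ∑ j ∈ Finset.range L, pat (dg j) * 2 ^ (p * j) := by
  intro L
  induction L with
  | zero => intro dg _; simp [hE0]
  | succ L ih =>
    intro dg hdg
    rw [Finset.sum_range_succ', Finset.sum_range_succ']
    have h1 : (∑ j ∈ Finset.range L, dg (j + 1) * 2 ^ (a * (j + 1))) + dg 0 * 2 ^ (a * 0) =
        2 ^ a * (∑ j ∈ Finset.range L, dg (j + 1) * 2 ^ (a * j)) + dg 0 := by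
      rw [Finset.mul_sum, mul_zero, pow_zero, mul_one]
      congr 1
      refine Finset.sum_congr rfl fun j _ => ?_
      rw [show a * (j + 1) = a * j + a by ring, pow_add]
      ring
    rw [h1, hE _ _ (hdg 0), ih (fun j => dg (j + 1)) (fun j => hdg (j + 1)), Finset.mul_sum, mul_zero,
      pow_zero, mul_one]
    congr 1
    refine Finset.sum_congr rfl fun j _ => ?_
    rw [show p * (j + 1) = p * j + p by ring, pow_add]
    ring

/-- `(x ↦ 2^a x + (2^a - 1))^[L] 0 = Σ_{j<L} (2^a - 1) 2^{aj}` (all row digits of `L` periods set). [folklore] -/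
theorem iterate_eq_sum (a L : ℕ) :
    (fun x : ℕ => 2 ^ a * x + (2 ^ a - 1))^[L] 0 = ∑ j ∈ Finset.range L, (2 ^ a - 1) * 2 ^ (a * j) := by
  induction L with
  | zero => simp
  | succ L ih =>
    rw [Function.iterate_succ_apply', ih, Finset.sum_range_succ', Finset.mul_sum, mul_zero, pow_zero, mul_one]
    congr 1
    refine Finset.sum_congr rfl fun j _ => ?_
    rw [show a * (j + 1) = a * j + a by ring, pow_add]
    ring

/-! ### §2 The ratio criterion -/

/-- `λ(n)·λ(n) = 1` for `n ≠ 0`. [folklore] -/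
theorem liouville_mul_self {n : ℕ} (hn : n ≠ 0) : liouville n * liouville n = 1 := by
  rw [liouville_apply hn]
  rcases neg_one_pow_eq_or ℤ (cardFactors n) with h | h <;> rw [h] <;> norm_num

/-- ★ **Ratio criterion (abstract periodic form).**  Spreading maps `E_R, E_C` with
`E_X(2^a x + d) = 2^p E_X(x) + pat_X(d)`, `E_X(0) = 0`, `pat_R(2^a-1) + pat_C(2^a-1) + 1 = 2^p`; a witness
`q ≥ 1` with digits `d_q, d_q' < 2^a`, `pat_C(d_q) = q`, `pat_C(d_q') = q - 1`, and `λ(pat_R(2^a-1) + q) ≠ λ(q)`.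
Then `(λ(1 + E_R x + E_C y))_{x, y ∈ ℕ}` has infinitely many distinct rows. [this file] -/
theorem infinite_rows_of_ratioWitness (ER EC patR patC : ℕ → ℕ) (a p mR mC : ℕ)
    (hER0 : ER 0 = 0) (hEC0 : EC 0 = 0)
    (hER : ∀ x d, d < 2 ^ a → ER (2 ^ a * x + d) = 2 ^ p * ER x + patR d)
    (hEC : ∀ y d, d < 2 ^ a → EC (2 ^ a * y + d) = 2 ^ p * EC y + patC d)
    (hmR : patR (2 ^ a - 1) = mR) (hmC : patC (2 ^ a - 1) = mC) (hm : mR + mC + 1 = 2 ^ p)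
    (q dq dq' : ℕ) (hq : 1 ≤ q) (hdq : dq < 2 ^ a) (hdq' : dq' < 2 ^ a)
    (hpq : patC dq = q) (hpq' : patC dq' = q - 1)
    (hl : liouville (mR + q) ≠ liouville q) :
    (Set.range fun x y : ℕ => liouville (1 + ER x + EC y)).Infinite := by
  intro hfin
  have ha : 1 ≤ 2 ^ a := Nat.one_le_two_pow
  -- self-similarity under `x ↦ 2^a x + (2^a - 1)` on both indices
  have hF : ∀ x y : ℕ, liouville (1 + ER (2 ^ a * x + (2 ^ a - 1)) + EC (2 ^ a * y + (2 ^ a - 1))) =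
      liouville (2 ^ p) * liouville (1 + ER x + EC y) := by
    intro x y
    rw [hER x _ (by omega), hEC y _ (by omega), hmR, hmC]
    have h : 1 + (2 ^ p * ER x + mR) + (2 ^ p * EC y + mC) = 2 ^ p * (1 + ER x + EC y) := by
      rw [← hm]; ring
    rw [h, liouville_apply_mul]
  have hs : liouville (2 ^ p) * liouville (2 ^ p) = 1 := liouville_mul_self (by positivity)
  obtain ⟨L, hL1, hL⟩ := exists_iterate_rows_eq (fun x y : ℕ => liouville (1 + ER x + EC y))
    (fun x => 2 ^ a * x + (2 ^ a - 1)) (fun y => 2 ^ a * y + (2 ^ a - 1)) (liouville (2 ^ p)) hs hF hfin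
  have hrow := hL 0
  rw [iterate_eq_sum] at hrow
  -- `G = Σ_{j<L} 2^{pj} ≥ 1`; the row index has `E_R = mR * G`
  obtain ⟨L', rfl⟩ := Nat.exists_eq_add_of_le' hL1
  set G : ℕ := ∑ j ∈ Finset.range (L' + 1), 2 ^ (p * j) with hG
  have hG1 : 1 ≤ G := by
    rw [hG, Finset.sum_range_succ']
    simp
  have hX : ER (∑ j ∈ Finset.range (L' + 1), (2 ^ a - 1) * 2 ^ (a * j)) = mR * G := by
    rw [spread_sum_digits ER patR a p hER0 hER (L' + 1) (fun _ => 2 ^ a - 1) (fun _ => by omega), hmR, hG,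
      Finset.mul_sum]
  -- the witness column `y = d_q' + Σ_{1 ≤ j < L} d_q 2^{aj}` has `E_C y + 1 = q * G`
  have hY : EC (∑ j ∈ Finset.range (L' + 1), (fun j : ℕ => if j = 0 then dq' else dq) j * 2 ^ (a * j)) + 1 =
      q * G := by
    rw [spread_sum_digits EC patC a p hEC0 hEC (L' + 1) (fun j : ℕ => if j = 0 then dq' else dq)
      (fun j => by by_cases hj : j = 0 <;> simp [hj, hdq, hdq'])]
    rw [hG, Finset.sum_range_succ', Finset.sum_range_succ', if_pos (rfl : (0 : ℕ) = 0)]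
    have e1 : ∀ k : ℕ, (if k + 1 = 0 then dq' else dq) = dq := fun k => if_neg (Nat.succ_ne_zero k)
    simp only [e1, hpq, hpq', mul_zero, pow_zero, mul_one]
    rw [mul_add, mul_one, Finset.mul_sum]
    omega
  -- evaluate the row equality at the witness column
  have h1 := congrFun hrow (∑ j ∈ Finset.range (L' + 1), (fun j : ℕ => if j = 0 then dq' else dq) j * 2 ^ (a * j))
  simp only at h1
  rw [hX, hER0] at h1
  set Y := EC (∑ j ∈ Finset.range (L' + 1), (fun j : ℕ => if j = 0 then dq' else dq) j * 2 ^ (a * j)) with hYdef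
  set B := q * G with hB
  have hB1 : 1 ≤ B := by rw [hB]; nlinarith
  have e1 : 1 + mR * G + Y = (mR + q) * G := by rw [add_mul, ← hB]; omega
  have e2 : 1 + 0 + Y = q * G := by omega
  rw [e1, e2, liouville_apply_mul, liouville_apply_mul] at h1
  have hGne : liouville G ≠ 0 := liouville_ne_zero (by omega)
  exact hl (mul_right_cancel₀ hGne h1)

/-! ### §3 From infinitely many rows to unbounded cut rank -/

/-- **Bridge.**  If `(λ(1 + E_R x + E_C y))_{x,y}` has infinitely many distinct rows, then for every `W`,
eventually every cut `π` whose cut number splits as `N_π(r, c) = E_R(ofBits r) + E_C(ofBits c)` has rank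
`≥ W` (`2^W` distinct infinite rows are separated at finitely many columns; `#rows ≤ 2^{rank}`). [this file] -/
theorem cutRank_of_infinite_rows (ER EC : ℕ → ℕ)
    (hinf : (Set.range fun x y : ℕ => liouville (1 + ER x + EC y)).Infinite) (W : ℕ) :
    ∃ n₀ : ℕ, ∀ n ≥ n₀, ∀ π : Fin n ⊕ Fin n ≃ Fin (2 * n),
      (∀ r c : Fin n → Bool, Nat.ofBits (fun k : Fin (2 * n) => Sum.elim r c (π.symm k)) =
        ER (Nat.ofBits r) + EC (Nat.ofBits c)) →
      W ≤ (Matrix.of fun r c : Fin n → Bool =>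
        (((liouville (Nat.ofBits (fun k : Fin (2 * n) => Sum.elim r c (π.symm k)) + 1) : ℤ) : ℂ))).rank := by
  classical
  obtain ⟨T, hTsub, hTcard⟩ := hinf.exists_subset_card_eq (2 ^ W)
  have hrep : ∀ ρ ∈ T, ∃ x : ℕ, (fun y => liouville (1 + ER x + EC y)) = ρ := fun ρ hρ =>
    hTsub (Finset.mem_coe.mpr hρ)
  choose! X hX using hrep
  have hsep : ∀ ρ ∈ T, ∀ ρ' ∈ T, ρ ≠ ρ' → ∃ y : ℕ, ρ y ≠ ρ' y := fun ρ _ ρ' _ h =>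
    Function.ne_iff.mp h
  choose! Y hY using hsep
  refine ⟨T.sup X + T.sup (fun ρ => T.sup (Y ρ)) + 1, fun n hn π hπ => ?_⟩
  have h2n : T.sup X + T.sup (fun ρ => T.sup (Y ρ)) < 2 ^ n :=
    lt_of_lt_of_le (lt_of_lt_of_le (Nat.lt_succ_self _) hn) (Nat.lt_two_pow_self).le
  have hXlt : ∀ ρ ∈ T, X ρ < 2 ^ n := fun ρ hρ =>
    lt_of_le_of_lt ((Finset.le_sup (f := X) hρ).trans (Nat.le_add_right _ _)) h2n
  have hYlt : ∀ ρ ∈ T, ∀ ρ' ∈ T, Y ρ ρ' < 2 ^ n := fun ρ hρ ρ' hρ' =>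
    lt_of_le_of_lt (((Finset.le_sup (f := Y ρ) hρ').trans
      (Finset.le_sup (f := fun ρ => T.sup (Y ρ)) hρ)).trans (Nat.le_add_left _ _)) h2n
  set M := (Matrix.of fun r c : Fin n → Bool =>
      (((liouville (Nat.ofBits (fun k : Fin (2 * n) => Sum.elim r c (π.symm k)) + 1) : ℤ) : ℂ)))
    with hM
  have hpm : ∀ r c, M r c = 1 ∨ M r c = -1 := by
    intro r c
    rw [hM, Matrix.of_apply, liouville_apply (Nat.succ_ne_zero _)]
    rcases neg_one_pow_eq_or ℤ
        (cardFactors (Nat.ofBits (fun k : Fin (2 * n) => Sum.elim r c (π.symm k)) + 1)) with h | h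
    · left; rw [h]; norm_num
    · right; rw [h]; norm_num
  have hbits : ∀ x < 2 ^ n, Nat.ofBits (fun i : Fin n => x.testBit i) = x := fun x hx => by
    rw [Nat.ofBits_testBit, Nat.mod_eq_of_lt hx]
  have hentry : ∀ x < 2 ^ n, ∀ y < 2 ^ n,
      M (fun i : Fin n => x.testBit i) (fun i : Fin n => y.testBit i) =
        ((liouville (1 + ER x + EC y) : ℤ) : ℂ) := by
    intro x hx y hy
    rw [hM, Matrix.of_apply, hπ, hbits x hx, hbits y hy, show ER x + EC y + 1 = 1 + ER x + EC y by ring]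
  have hinj : Set.InjOn (fun ρ : ℕ → ℤ => M (fun i : Fin n => (X ρ).testBit i)) ↑T := by
    intro ρ hρ ρ' hρ' h
    by_contra hne
    have h1 := congrFun h (fun i : Fin n => (Y ρ ρ').testBit i)
    simp only at h1
    rw [hentry _ (hXlt ρ hρ) _ (hYlt ρ hρ ρ' hρ'), hentry _ (hXlt ρ' hρ') _ (hYlt ρ hρ ρ' hρ')] at h1
    have h2 : liouville (1 + ER (X ρ) + EC (Y ρ ρ')) = liouville (1 + ER (X ρ') + EC (Y ρ ρ')) := by
      exact_mod_cast h1
    have h3 := congrFun (hX ρ hρ) (Y ρ ρ')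
    have h4 := congrFun (hX ρ' hρ') (Y ρ ρ')
    rw [h3, h4] at h2
    exact hY ρ hρ ρ' hρ' hne h2
  have hcard : T.card ≤ (Finset.univ.image fun r : Fin n → Bool => M r).card := by
    calc T.card = (T.image fun ρ : ℕ → ℤ => M (fun i : Fin n => (X ρ).testBit i)).card :=
          (Finset.card_image_of_injOn hinj).symm
      _ ≤ (Finset.univ.image fun r : Fin n → Bool => M r).card := by
          refine Finset.card_le_card fun v hv => ?_
          obtain ⟨ρ, -, rfl⟩ := Finset.mem_image.mp hv
          exact Finset.mem_image.mpr ⟨_, Finset.mem_univ _, rfl⟩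
  have hrank := card_image_row_le_two_pow_rank M hpm
  have hle : 2 ^ W ≤ 2 ^ M.rank := hTcard ▸ hcard.trans hrank
  exact (Nat.pow_le_pow_iff_right (by norm_num)).mp hle

/-- ★★ **Ratio criterion for periodic cut families.**  Under the hypotheses of `infinite_rows_of_ratioWitness`
(spreading maps of a periodic pattern and an arithmetic certificate `q`), for every `W`, eventually every cut
whose cut number splits as `N_π(r, c) = E_R(ofBits r) + E_C(ofBits c)` has rank `≥ W`. [this file] -/
theorem cutRank_of_ratioWitness (ER EC patR patC : ℕ → ℕ) (a p mR mC : ℕ)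
    (hER0 : ER 0 = 0) (hEC0 : EC 0 = 0)
    (hER : ∀ x d, d < 2 ^ a → ER (2 ^ a * x + d) = 2 ^ p * ER x + patR d)
    (hEC : ∀ y d, d < 2 ^ a → EC (2 ^ a * y + d) = 2 ^ p * EC y + patC d)
    (hmR : patR (2 ^ a - 1) = mR) (hmC : patC (2 ^ a - 1) = mC) (hm : mR + mC + 1 = 2 ^ p)
    (q dq dq' : ℕ) (hq : 1 ≤ q) (hdq : dq < 2 ^ a) (hdq' : dq' < 2 ^ a)
    (hpq : patC dq = q) (hpq' : patC dq' = q - 1)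
    (hl : liouville (mR + q) ≠ liouville q) (W : ℕ) :
    ∃ n₀ : ℕ, ∀ n ≥ n₀, ∀ π : Fin n ⊕ Fin n ≃ Fin (2 * n),
      (∀ r c : Fin n → Bool, Nat.ofBits (fun k : Fin (2 * n) => Sum.elim r c (π.symm k)) =
        ER (Nat.ofBits r) + EC (Nat.ofBits c)) →
      W ≤ (Matrix.of fun r c : Fin n → Bool =>
        (((liouville (Nat.ofBits (fun k : Fin (2 * n) => Sum.elim r c (π.symm k)) + 1) : ℤ) : ℂ))).rank :=
  cutRank_of_infinite_rows ER EC (infinite_rows_of_ratioWitness ER EC patR patC a p mR mC hER0 hEC0 hER hEC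
    hmR hmC hm q dq dq' hq hdq hdq' hpq hpq' hl) W

end Summit.ValiantsHypothesis.ValiantsHypothesis.Theorems.LiouvilleSarnakLiouvilleCutRank.PeriodicRatio

end
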